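import Mathlib
import Literature.AlgebraicGeometry.RelativeSpec.FiniteGroupQuotient

/-!
# Cyclic divisorial transfer — stalk form ⟹ chart form of the divisorial hypothesis

(crux stmt-ResolutionOfSingularities-15640, line `Sketch`, stub `stub_augIdeal_localization_of_stalk`)

For an action `ρ` of a group `G` on `X` over `r : X ⟶ Y` (`ActionOver r G`), an open `U ⊆ Y` with
`r⁻¹U` affine, `g ∈ G` and a point `x ∈ r⁻¹U` fixed by `g⁻¹`, the stalk `𝒪_{X,x}` is the
localisation of the ring of sections `B = Γ(X, r⁻¹U)` at the prime `𝔮` of `x`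
(`IsAffineOpen.isLocalization_stalk`), and the germ map `B → 𝒪_{X,x}` intertwines the action
`act g U = (g⁻¹)♯` on `B` with the stalk endomorphism `a = stalkSpecializes ≫ (g⁻¹).stalkMap x`
(`germ_act`). Hence the extension of the augmentation ideal `(act g b - b : b ∈ B)` to the stalk is
the augmentation ideal `(a s - s : s ∈ 𝒪_{X,x})` of `a` (`map_augIdeal_germ`: every germ is
`s = b / t`, and `(a s - s) t = (a b - b) - a s (a t - t)`), and principality of the latter gives
principality of the extension to `B_𝔮 ≅ 𝒪_{X,x}` (`stub_augIdeal_localization_of_stalk`).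
-/

set_option linter.dupNamespace false

noncomputable section

open CategoryTheory Limits AlgebraicGeometry TopologicalSpace
open Literature.AlgebraicGeometry.RelativeSpec

namespace Summit.ResolutionOfSingularities.ResolutionOfSingularities.Theorems.WildQuotientResolution.CyclicTransfer

variable {X Y : Scheme.{0}} {r : X ⟶ Y} {G : Type} [Group G]

/-- **The germ map intertwines the two actions.** For `b ∈ Γ(X, r⁻¹U)` and a point `x ∈ r⁻¹U`
fixed by `g⁻¹`, the germ at `x` of `act g U b = (g⁻¹)♯ b` is the image of the germ of `b` under the
stalk endomorphism `stalkSpecializes ≫ (g⁻¹).stalkMap x` (`Scheme.Hom.germ_stalkMap`,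
`TopCat.Presheaf.germ_stalkSpecializes`). [folklore] -/
theorem germ_act (ρ : ActionOver r G) (U : Y.Opens) (g : G) (x : X) (hxU : x ∈ r ⁻¹ᵁ U)
    (hgx : (ρ.aut g⁻¹).hom.base x = x) (b : Γ(X, r ⁻¹ᵁ U)) :
    (X.presheaf.germ (r ⁻¹ᵁ U) x hxU).hom (ρ.act g U b) =
      (X.presheaf.stalkSpecializes (specializes_of_eq hgx) ≫ (ρ.aut g⁻¹).hom.stalkMap x).hom
        ((X.presheaf.germ (r ⁻¹ᵁ U) x hxU).hom b) := by
  rw [ActionOver.act_apply, CommRingCat.comp_apply, TopCat.Presheaf.germ_stalkSpecializes_apply,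
    Scheme.Hom.germ_stalkMap_apply, Scheme.Hom.appLE, CommRingCat.comp_apply,
    TopCat.Presheaf.germ_res_apply]

/-- **The extended augmentation ideal is the augmentation ideal of the stalk action.** With
`B = Γ(X, r⁻¹U)` (`r⁻¹U` affine), `x ∈ r⁻¹U` fixed by `g⁻¹` and
`a = stalkSpecializes ≫ (g⁻¹).stalkMap x` the induced endomorphism of `𝒪_{X,x}`, the extension
along the germ map `B → 𝒪_{X,x}` of the ideal `(act g b - b : b ∈ B)` is the ideal
`(a s - s : s ∈ 𝒪_{X,x})`: `⊆` by `germ_act`; `⊇` because `𝒪_{X,x} = B_𝔮`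
(`IsAffineOpen.isLocalization_stalk`), so every `s` satisfies `s · t = b` for germs `b`, `t` of
sections with `t` a unit, and then `(a s - s) · t = (a b - b) - a s · (a t - t)`. [folklore] -/
theorem map_augIdeal_germ (ρ : ActionOver r G) (U : Y.Opens) (hU : IsAffineOpen (r ⁻¹ᵁ U))
    (g : G) (x : X) (hxU : x ∈ r ⁻¹ᵁ U) (hgx : (ρ.aut g⁻¹).hom.base x = x) :
    (Ideal.span (Set.range fun b : Γ(X, r ⁻¹ᵁ U) => ρ.act g U b - b)).map
        (X.presheaf.germ (r ⁻¹ᵁ U) x hxU).hom =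
      Ideal.span (Set.range fun s : X.presheaf.stalk x =>
        (X.presheaf.stalkSpecializes (specializes_of_eq hgx) ≫ (ρ.aut g⁻¹).hom.stalkMap x).hom s -
          s) := by
  letI : Algebra Γ(X, r ⁻¹ᵁ U) (X.presheaf.stalk x) :=
    TopCat.Presheaf.algebra_section_stalk X.presheaf ⟨x, hxU⟩
  haveI : IsLocalization.AtPrime (X.presheaf.stalk x) (hU.primeIdealOf ⟨x, hxU⟩).asIdeal :=
    hU.isLocalization_stalk ⟨x, hxU⟩
  set a := X.presheaf.stalkSpecializes (specializes_of_eq hgx) ≫ (ρ.aut g⁻¹).hom.stalkMap x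
    with ha
  set γ := X.presheaf.germ (r ⁻¹ᵁ U) x hxU with hγ
  have hγa : ∀ b, γ.hom (ρ.act g U b) = a.hom (γ.hom b) := germ_act ρ U g x hxU hgx
  set J := (Ideal.span (Set.range fun b : Γ(X, r ⁻¹ᵁ U) => ρ.act g U b - b)).map γ.hom with hJ
  have hmem : ∀ b, a.hom (γ.hom b) - γ.hom b ∈ J := fun b => by
    rw [← hγa, ← map_sub]
    exact Ideal.mem_map_of_mem _ (Ideal.subset_span ⟨b, rfl⟩)
  apply le_antisymm
  · rw [hJ, Ideal.map_span]
    refine Ideal.span_le.mpr ?_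
    rintro _ ⟨_, ⟨b, rfl⟩, rfl⟩
    refine Ideal.subset_span ⟨γ.hom b, ?_⟩
    simp only [map_sub, hγa]
  · refine Ideal.span_le.mpr ?_
    rintro _ ⟨s, rfl⟩
    obtain ⟨⟨b, t⟩, hs⟩ := IsLocalization.surj (hU.primeIdealOf ⟨x, hxU⟩).asIdeal.primeCompl s
    have hu : IsUnit (γ.hom t) := IsLocalization.map_units (X.presheaf.stalk x) t
    change s * γ.hom t = γ.hom b at hs
    have key : (a.hom s - s) * γ.hom t =
        (a.hom (γ.hom b) - γ.hom b) - a.hom s * (a.hom (γ.hom t) - γ.hom t) := by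
      rw [← hs, map_mul]
      ring
    rw [SetLike.mem_coe, ← Ideal.mul_unit_mem_iff_mem J hu, key]
    exact J.sub_mem (hmem b) (J.mul_mem_left _ (hmem t))

/-- **Stalk form ⟹ chart form of the divisorial hypothesis.** For an action `ρ` over
`r : X → Y`, an open `U ⊆ Y` with `r⁻¹U` affine, `g ∈ G` and a point `x ∈ r⁻¹U` fixed by `g⁻¹`:
if the augmentation ideal of the stalk endomorphism `a = stalkSpecializes ≫ (g⁻¹).stalkMap x` of
`𝒪_{X,x}` is principal, then the extension to the local ring `Γ(X, r⁻¹U)_𝔮` (`𝔮` the prime of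
`x`, `IsAffineOpen.primeIdealOf`) of the augmentation ideal `(act g b - b : b)` of the action on
sections (`ActionOver.act g U = (g⁻¹)♯`) is principal: under `Γ(X, r⁻¹U)_𝔮 ≅ 𝒪_{X,x}`
(`IsAffineOpen.isLocalization_stalk`, `IsLocalization.algEquiv`) the extended ideal is the
augmentation ideal of `a` (`map_augIdeal_germ`), and images of principal ideals are principal.
[folklore] -/
theorem stub_augIdeal_localization_of_stalk {X Y : Scheme.{0}} {r : X ⟶ Y} {G : Type} [Group G]
    (ρ : ActionOver r G) (U : Y.Opens) (hU : IsAffineOpen (r ⁻¹ᵁ U)) (g : G)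
    (x : X) (hxU : x ∈ r ⁻¹ᵁ U) (hgx : (ρ.aut g⁻¹).hom.base x = x)
    (hdiv : (Ideal.span (Set.range fun s : X.presheaf.stalk x =>
        (X.presheaf.stalkSpecializes (specializes_of_eq hgx) ≫ (ρ.aut g⁻¹).hom.stalkMap x).hom s -
          s)).IsPrincipal) :
    ((Ideal.span (Set.range fun b : Γ(X, r ⁻¹ᵁ U) => ρ.act g U b - b)).map
      (algebraMap Γ(X, r ⁻¹ᵁ U)
        (Localization.AtPrime (hU.primeIdealOf ⟨x, hxU⟩).asIdeal))).IsPrincipal := by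
  letI : Algebra Γ(X, r ⁻¹ᵁ U) (X.presheaf.stalk x) :=
    TopCat.Presheaf.algebra_section_stalk X.presheaf ⟨x, hxU⟩
  haveI : IsLocalization.AtPrime (X.presheaf.stalk x) (hU.primeIdealOf ⟨x, hxU⟩).asIdeal :=
    hU.isLocalization_stalk ⟨x, hxU⟩
  let e := IsLocalization.algEquiv (hU.primeIdealOf ⟨x, hxU⟩).asIdeal.primeCompl
    (X.presheaf.stalk x) (Localization.AtPrime (hU.primeIdealOf ⟨x, hxU⟩).asIdeal)
  rw [← e.toAlgHom.comp_algebraMap, ← Ideal.map_map]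
  refine Submodule.IsPrincipal.map_ringHom _ ?_
  have halg : algebraMap Γ(X, r ⁻¹ᵁ U) (X.presheaf.stalk x) =
      (X.presheaf.germ (r ⁻¹ᵁ U) x hxU).hom := rfl
  rw [halg, map_augIdeal_germ ρ U hU g x hxU hgx]
  exact hdiv

end Summit.ResolutionOfSingularities.ResolutionOfSingularities.Theorems.WildQuotientResolution.CyclicTransfer

end
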